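import Mathlib.Data.Nat.Choose.Multinomial
import Literature.Computability.AlgebraicComplexity.WordLiftWidth
import Literature.Computability.AlgebraicComplexity.TableauPolarization
import Literature.Computability.AlgebraicComplexity.PolynomialKoszulYoungFlatteningBorderRank
import Literature.Computability.AlgebraicComplexity.RankMethodBarriers
import Literature.Computability.AlgebraicComplexity.ValiantClasses
import HarnessLib

/-!
# Bläser–Dörfler–Ikenmeyer 2020/2021, §4 and §6: ABP width complexity, noncommutative ABP width,
# `VW̄aring ⊆ VBP`, `w(f) ≤ ncw(f) ≤ W̄R(f)`, Nisan widths of symmetric tensors, Question 6.9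

Typed literature (cell `val-lit`, cross-ladder typing seat x6; D-0064: one file per source
section-group; this file = §4 "Border Waring rank and algebraic branching programs" and §6
"Non-commutative algebraic branching programs" of the source; the sibling
`BDI20HwvEvaluationHardness.lean` types §5, §7, §8). HONEST FRAMING: cite-tagged statements of
published results; typed ≠ proved ≠ endorsed; `VP ≠ VNP` is NOT proved and nothing here is
progress on it (LADDER-VALIANT V4, row N4 "constructivity side": the complexity of EVALUATING the
separating functions of geometric complexity theory).

Source: M. Bläser, J. Dörfler, C. Ikenmeyer, *On the complexity of evaluating highest weight
vectors*, arXiv:2002.11594 (2020) [BlaserDorflerIkenmeyer2020]; published: 36th Computational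
Complexity Conference (CCC 2021), LIPIcs 200, Art. 29, doi:10.4230/LIPIcs.CCC.2021.29.
NUMBERING: decl names and `[cite:]` tags use the PUBLISHED (CCC 2021) numbering `Thm 4.1`,
`Thm 4.2`, `Prop 6.6`, `Cor 6.7`, `Cor 6.8`, `Question 6.9` (checked on the LIPIcs PDF text, held as
`paper:url-50d0afcf7594`, pages `29:N` = file `p00NN.txt`); the held arXiv text
`paper:arxiv-2002.11594` (corpus-tex, 25 chunks `pNNNN.txt`) numbers the same environments
SEQUENTIALLY — arXiv `Theorem 1` = CCC Thm 4.1, `Theorem 2` = Thm 4.2, `Definition 7` = Def 6.1,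
`Theorem 8` = Thm 6.2, `Proposition 12` = Prop 6.6, `Corollary 13/14` = Cor 6.7/6.8, `Question 15` =
Question 6.9 — and every docstring gives both locators. Statements are identical in both versions.

## What §4/§6 say, and how it is typed over the tree

BDI work over `ℂ`. An ABP (§4, arXiv p0006.txt:L6-16; CCC p.29:5) is a layered DAG, `d` layers of
edges labelled by homogeneous LINEAR forms, computing the sum over source–sink paths of the products
of the labels; its width is the largest layer; `w(f)` = least width of a (commutative) ABP computing
`f ∈ ℂ[x_1..x_m]_d`; `VBP` = p-families with p-bounded `w`. `WR(f)`, `W̄R(f)` = Waring rank, border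
Waring rank (= the tree's `polyWaringRank`, `borderPolyWaringRank`, CITED not restated);
`VWaring`/`VW̄aring` = p-families with p-bounded (border) Waring rank. An ncABP (Def 6.1; arXiv
Def 7, p0010.txt:L5-32) has edge labels in `V = ℂ^m` and computes the TENSOR
`Σ_paths ℓ_1 ⊗ ⋯ ⊗ ℓ_d ∈ ⊗^d V`; "an ncABP computes the polynomial `f`" means it computes the
symmetric tensor of `f` under the canonical isomorphism `ℂ[x]_d ≅ Sym^d V`,
`x_{i_1}⋯x_{i_d} ↦ (1/d!) Σ_π e_{i_π(1)} ⊗ ⋯ ⊗ e_{i_π(d)}` (arXiv p0007.txt:L11-17; CCC p.29:7);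
`ncw(f)` = least width of such an ncABP.

RENDERING (read by referees).
* A tensor in `⊗^d ℂ^m` is a WORD TENSOR `Ψ : (Fin d → Fin m) → F` (the tree's convention of
  `WordLiftWidth.lean`: `IsWordLift Ψ f`, `wordFlattening`, `wordTTRank` are CITED). An ncABP of
  width `≤ w` is rendered by its transfer matrices: padding every layer to exactly `w` vertices
  (isolated padding vertices change no path sum), the label of the edge `a → b` of layer `t` has
  coordinate vector `(C t i a b)_{i < m}`, the source/sink are selected by vectors `u, v ∈ F^w`, and
  the computed tensor is `Ψ(i_1..i_d) = uᵀ · C_1[i_1] ⋯ C_d[i_d] · v` (`BDI2020.HasNcABPWidthLE`).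
  For `w ≥ 1` this is literally "there is an ncABP of width `≤ w` computing `Ψ`" (absorb `u`, `v`
  into the first/last layer); at `w = 0` only `Ψ = 0` qualifies, so the typed `ncw(0) = 0` where the
  printed convention would give `1` — immaterial for every statement below.
* A commutative ABP with linear-form labels IS an ncABP with vector labels read commutatively
  ("Every ncABP can be reinterpreted as a cABP by letting the variables commute", arXiv
  p0007.txt:L22): `BDI2020.HasABPWidthLE w d f := ∃ Ψ, IsWordLift Ψ f ∧ HasNcABPWidthLE w Ψ`.
* `w(f)`, `ncw(Ψ)`, `ncw(f)` are `sInf`s (`abpWidth`, `ncAbpWidth`, `ncAbpWidthPoly`); junk value `0`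
  only when no program exists, which never happens for the homogeneous `f` of degree `d ≥ 1` the
  paper speaks about (a form is a sum of monomials, each a path).
* The symmetric tensor of `f` (`BDI2020.symTensor`): `Ψ_f(i) = coeff_{α(i)}(f) · α(i)! / d!`,
  `α(i)` the content of the word `i` (tree: `TableauEval.wordContent`, `TableauEval.ffact`) — the
  image of `f` under the displayed isomorphism (a monomial `x^α` has `d!/α!` words). Needs
  characteristic `0` (division by `d!/α!`); typed over a field with `CharZero` where used.
* p-families: the tree's `IsPBounded` (`ValiantClasses.lean`, Bürgisser Def. 2.1(1)); a family is
  `f : ∀ n, MvPolynomial (Fin (m n)) ℂ` with `f n` homogeneous of degree `d n`, `m`, `d` p-bounded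
  (BDI p0006.txt:L13-16: "number of variables and the degree of each `f_n` are polynomially
  bounded").
* Degree `0` is excluded where the paper's objects need `d ≥ 1` layers (hypothesis `0 < d`); see the
  docstring of `BDI2020_thm_4_2` for why the typed junk conventions force this.
* FACT-LIST marks: `-- FACT` (published result, unproved in the tree: a `def … : Prop`, never
  asserted), `-- OPEN QUESTION` (printed as open; neutral `Prop`, never asserted, not a conjecture of
  ours), `-- PROVED` (small API proved here). No `instance`, no `notation`, no attribute games.

ADDED 2026-08-27 (seat x6 g6, lead-np RULING (95)(c)): the INTENDED `q(k,d)` readings of Question 6.9,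
`BDI2020_question_6_9a_kd` / `BDI2020_question_6_9b_kd` (OPEN QUESTIONS, neutral), after the literal
`d`-uniform `BDI2020_question_6_9a` was decided in the negative (`not_BDI2020_question_6_9a`,
`BDI20WaringBorderWaringGap.lean`); the sibling proof files `BDI20WaringBorderWaringGap.lean`,
`BDI20NcABPWidthBorderWaringGap.lean`, `BDI20NcABPWidthClosed.lean` now PROVE eq. (4.1), Cor 6.7 (width
clause) and Cor 6.8 with both strictness examples.

NOT typed here: eq. (4.1) `w(f) ≤ W̄R(f)·(md+d+1)·(d+1)` (superseded by Thm 4.2, same page); the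
read-once-oblivious-ABP sketch of the standard proof of Thm 4.1 (Saxena duality, Forbes, Nisan);
Cor 6.7/6.8's strictness examples (`x^{d-1}y`, the `2 × 2` matrix multiplication polynomial).

## References
* [BlaserDorflerIkenmeyer2020] arXiv:2002.11594, §4 (Thm 1 = CCC Thm 4.1, Thm 2 = CCC Thm 4.2),
  §6 (Def 7 = CCC Def 6.1, Prop 12 = CCC Prop 6.6, Cor 13/14 = CCC Cor 6.7/6.8, Question 15 = CCC
  Question 6.9); CCC 2021, LIPIcs 200:29, pp. 29:5–29:7, 29:10–29:14.
* N. Nisan, *Lower bounds for non-commutative computation*, STOC 1991, Thm. 1 (the rank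
  characterisation behind Prop 6.6; tree file `WordLiftWidth.lean`).
* [LandsbergGCT2017] §6.2.2 (border Waring rank; tree `borderPolyWaringRank`),
  [EfremenkoGargOliveiraWigderson2018] Def. 4.1 (Waring rank; tree `polyWaringRank`).
-/

noncomputable section

open MvPolynomial Matrix

namespace Literature.Computability.AlgebraicComplexity

namespace BDI2020

/-! ### §6 Def 6.1 (arXiv Def 7): noncommutative ABPs of width `≤ w` and the tensor they compute -/

section NcABP

variable {F : Type*} [CommRing F] {d m : ℕ}

-- PROVED (definition)
/-- **ncABP of width `≤ w` computing the tensor `Ψ ∈ ⊗^d F^m`** (BDI Def 6.1 = arXiv Def 7: "an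
acyclic directed graph with two distinguished nodes `s` and `t` and edges labeled with elements from
`V` and every path from `s` to `t` having the same length … The tensor computed by `A` is
`Σ_{s-t paths P} ℓ_1 ⊗ ⋯ ⊗ ℓ_d` … The width of an ncABP is the largest number of vertices in any
layer"), in transfer-matrix form: every layer padded to `w` vertices, `C t i` = the `w × w` matrix
of `i`-th coordinates of the labels of the edges of layer `t`, `u`/`v` select source/sink, and the
entry of the computed tensor at the word `i = (i_1, …, i_d)` is `uᵀ C_1[i_1] ⋯ C_d[i_d] v`.
[cite: BlaserDorflerIkenmeyer2020, Def 7 (arXiv; = CCC 2021 Def 6.1)] locator: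
paper:arxiv-2002.11594 p0010.txt:L5-32; CCC p.29:10 -/
def HasNcABPWidthLE (w : ℕ) (Ψ : (Fin d → Fin m) → F) : Prop :=
  ∃ (C : Fin d → Fin m → Matrix (Fin w) (Fin w) F) (u v : Fin w → F),
    ∀ i : Fin d → Fin m, Ψ i = u ⬝ᵥ ((List.ofFn fun t => C t (i t)).prod *ᵥ v)

-- PROVED (definition)
/-- **`ncw(Ψ)`**, the noncommutative ABP width complexity of a tensor: the least `w` admitting an
ncABP of width `≤ w` computing `Ψ` (§4: "For noncommutative polynomials we define the analogous
versions `ncw` …"; Def 6.1). Junk value `0` if none exists (never, for finite `d`, `m` over a ring: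
every tensor is a sum of `m^d` paths). [cite: BlaserDorflerIkenmeyer2020, §4 and Def 7 (arXiv; = CCC Def 6.1)]
locator: paper:arxiv-2002.11594 p0006.txt:L31, p0010.txt:L32; CCC p.29:5, 29:10 -/
def ncAbpWidth (Ψ : (Fin d → Fin m) → F) : ℕ :=
  sInf {w | HasNcABPWidthLE w Ψ}

-- PROVED (API)
/-- A program of width `≤ w` bounds `ncw`. [cite: BlaserDorflerIkenmeyer2020, Def 7 (arXiv; = CCC Def 6.1)] -/
theorem ncAbpWidth_le {w : ℕ} {Ψ : (Fin d → Fin m) → F} (h : HasNcABPWidthLE w Ψ) :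
    ncAbpWidth Ψ ≤ w :=
  Nat.sInf_le h

-- PROVED (definition)
/-- **Symmetric tensors** `Sym^d V ⊆ ⊗^d V`: "`T` is called symmetric if
`T_{i_1,…,i_d} = T_{i_π(1),…,i_π(d)}` for all permutations `π ∈ 𝔖_d`."
[cite: BlaserDorflerIkenmeyer2020, §4 (arXiv p0007.txt:L10; = CCC p.29:7)] -/
def IsSymmetricTensor (Ψ : (Fin d → Fin m) → F) : Prop :=
  ∀ (π : Equiv.Perm (Fin d)) (i : Fin d → Fin m), Ψ (i ∘ π) = Ψ i

end NcABP

/-! ### §4: the symmetric tensor of a form, ABP width `w(f)`, ncABP width `ncw(f)` -/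

section Widths

variable {F : Type*} [Field F] {m : ℕ}

-- PROVED (definition)
/-- **The symmetric tensor of a form** under the canonical isomorphism `F[x_1..x_m]_d ≅ Sym^d F^m`,
"`x_{i_1} x_{i_2} ⋯ x_{i_d} ↦ Σ_{π ∈ 𝔖_d} (1/d!) E_{π(i_1),…,π(i_d)}`" (so `x_1^2 x_2 ↦` the
W-state `(e_1⊗e_1⊗e_2 + e_1⊗e_2⊗e_1 + e_2⊗e_1⊗e_1)/3`): the entry at the word `i` with content
`α = α(i)` is `coeff_α(f) · α!/d!` (there are `d!/α!` words of content `α`). Characteristic `0` is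
needed for the division; stated over a field. [cite: BlaserDorflerIkenmeyer2020, §4 (arXiv p0007.txt:L11-17; = CCC p.29:7)] -/
def symTensor (d : ℕ) (f : MvPolynomial (Fin m) F) : (Fin d → Fin m) → F :=
  fun i => coeff (TableauEval.wordContent i) f *
    ((TableauEval.ffact (TableauEval.wordContent i) : F) / (d.factorial : F))

-- PROVED (definition)
/-- **Commutative ABP of width `≤ w` with `d` layers computing `f`**: an ncABP of width `≤ w` whose
computed tensor, read with commuting variables, is `f` ("We can view the same ABP both over
commuting variables or noncommuting variables … Every ncABP can be reinterpreted as a cABP by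
letting the variables commute"): some word tensor `Ψ` with `Σ_i Ψ(i) x_{i_1}⋯x_{i_d} = f` (tree:
`IsWordLift Ψ f`) has an ncABP of width `≤ w`. Equivalently: `f = uᵀ A_1 ⋯ A_d v` with `w × w`
matrices `A_t` of homogeneous linear forms. [cite: BlaserDorflerIkenmeyer2020, §4 (arXiv p0006.txt:L6-12, p0007.txt:L22; = CCC p.29:5, 29:7)] -/
def HasABPWidthLE (w d : ℕ) (f : MvPolynomial (Fin m) F) : Prop :=
  ∃ Ψ : (Fin d → Fin m) → F, IsWordLift Ψ f ∧ HasNcABPWidthLE w Ψ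

-- PROVED (definition)
/-- **`w(f)`, the ABP width complexity** of a homogeneous degree-`d` polynomial: "the smallest width
of a cABP computing `f`". Junk value `0` if no `d`-layer ABP computes `f` (i.e. `f` is not a form of
degree `d`). [cite: BlaserDorflerIkenmeyer2020, §4 (arXiv p0006.txt:L12; = CCC p.29:5)] -/
def abpWidth (d : ℕ) (f : MvPolynomial (Fin m) F) : ℕ :=
  sInf {w | HasABPWidthLE w d f}

-- PROVED (API)
/-- A `d`-layer ABP of width `≤ w` bounds `w(f)`. [cite: BlaserDorflerIkenmeyer2020, §4 (arXiv p0006.txt:L12)] -/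
theorem abpWidth_le {w d : ℕ} {f : MvPolynomial (Fin m) F} (h : HasABPWidthLE w d f) :
    abpWidth d f ≤ w :=
  Nat.sInf_le h

-- PROVED (definition)
/-- **`ncw(f)`, the noncommutative ABP width complexity of a FORM** of degree `d`: the least width of
an ncABP computing the symmetric tensor of `f` ("ncABPs can compute symmetric tensors", §4; "In
particular we will be looking at ncABPs computing symmetric tensors `p`", §6).
[cite: BlaserDorflerIkenmeyer2020, §4, §6 (arXiv p0006.txt:L31, p0007.txt:L18, p0010.txt:L32-36; = CCC p.29:5–29:7, 29:10)] -/
def ncAbpWidthPoly (d : ℕ) (f : MvPolynomial (Fin m) F) : ℕ :=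
  ncAbpWidth (symTensor d f)

end Widths

end BDI2020

/-! ### §4 Theorems 4.1 and 4.2 (arXiv Theorems 1 and 2) -/

section Section4

open BDI2020

-- FACT (standard; BDI: "the following result in this direction is known", with a sketch via Saxena's duality trick [Sax08], Forbes [For14] and Nisan [Nis91]; it also follows at once from Thm 4.2)
/-- **BDI Thm 4.1 (arXiv Thm 1): `VW̄aring ⊆ VBP`.** Every p-family of homogeneous polynomials over
`ℂ` with polynomially bounded border Waring rank has polynomially bounded ABP width complexity.
Typed for families `f n ∈ ℂ[x_1..x_{m(n)}]` homogeneous of degree `d n ≥ 1` with `m`, `d` p-bounded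
(the paper's p-families; degree-`0` members excluded, see `BDI2020_thm_4_2`), with the tree's
`borderPolyWaringRank` for `W̄R` and `BDI2020.abpWidth` for `w`.
[cite: BlaserDorflerIkenmeyer2020, Thm 1 (arXiv; = CCC 2021 Thm 4.1)] locator:
paper:arxiv-2002.11594 p0006.txt:L36-37 "Theorem 1. VW̄ ⊆ VBP"; CCC p.29:5 "▶ Theorem 4.1. VWaring ⊆ VBP." -/
def BDI2020_thm_4_1 : Prop :=
  ∀ (m d : ℕ → ℕ) (f : ∀ n, MvPolynomial (Fin (m n)) ℂ),
    (∀ n, (f n).IsHomogeneous (d n)) → (∀ n, 0 < d n) → IsPBounded m → IsPBounded d →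
    IsPBounded (fun n => borderPolyWaringRank (d n) (f n)) →
    IsPBounded (fun n => abpWidth (d n) (f n))

-- FACT
/-- **BDI Thm 4.2 (arXiv Thm 2).** "For all `f ∈ ℂ[x_1, …, x_m]_d` we have `w(f) ≤ W̄R(f)`": the ABP
width complexity is at most the border Waring rank — a sharp, `m`- and `d`-free form of Thm 4.1
("a structural side result … border Waring rank is bounded from above by the ABP width complexity",
abstract). Typed with `0 < d`: for `d = 0` the tree's `borderPolyWaringRank 0 (C c)` is the junk
value `0` unless `c ∈ ℕ` (Waring sums of `0`-th powers are the constants `r`), while a nonzero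
constant needs one source–sink path; the paper's ABPs have `d ≥ 1` layers.
[cite: BlaserDorflerIkenmeyer2020, Thm 2 (arXiv; = CCC 2021 Thm 4.2)] locator:
paper:arxiv-2002.11594 p0006.txt:L67-68; CCC p.29:6 "▶ Theorem 4.2. For all f ∈ C[x1,...,xm]d we have w(f) ≤ WR(f)." -/
def BDI2020_thm_4_2 : Prop :=
  ∀ (m d : ℕ) (f : MvPolynomial (Fin m) ℂ), f.IsHomogeneous d → 0 < d →
    abpWidth d f ≤ borderPolyWaringRank d f

-- FACT
/-- **BDI Thm 4.2, the chain actually proved**: "In fact, we prove `w(f) ≤ ncw(f) ≤ W̄R(f)`" (the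
first inequality: reinterpret an ncABP computing the symmetric tensor of `f` as a cABP; the second:
a border Waring decomposition gives a border ncABP with `s` disjoint paths, and Nisan's rank
characterisation shows border ncABP width = ncABP width). Same degree convention as
`BDI2020_thm_4_2`. [cite: BlaserDorflerIkenmeyer2020, Thm 2 and its proof (arXiv p0006.txt:L67-71, p0007.txt:L22-29; = CCC 2021 Thm 4.2, p.29:6–29:7)] -/
def BDI2020_thm_4_2_chain : Prop :=
  ∀ (m d : ℕ) (f : MvPolynomial (Fin m) ℂ), f.IsHomogeneous d → 0 < d →
    abpWidth d f ≤ ncAbpWidthPoly d f ∧ ncAbpWidthPoly d f ≤ borderPolyWaringRank d f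

-- PROVED
/-- The chain form implies Thm 4.2 as printed. [cite: BlaserDorflerIkenmeyer2020, Thm 2 (arXiv; = CCC 2021 Thm 4.2)] -/
theorem BDI2020_thm_4_2_of_chain (h : BDI2020_thm_4_2_chain) : BDI2020_thm_4_2 :=
  fun m d f hf hd => (h m d f hf hd).1.trans (h m d f hf hd).2

-- PROVED
/-- Thm 4.2 implies Thm 4.1 ("our sharp version of Theorem 4.1, Theorem 4.2"): a p-bounded border
Waring rank bounds the ABP width termwise. [cite: BlaserDorflerIkenmeyer2020, Thm 1–2 (arXiv; = CCC 2021 Thms 4.1–4.2, p.29:5 "to prove our sharp version of Theorem 4.1, Theorem 4.2")] -/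
theorem BDI2020_thm_4_1_of_thm_4_2 (h : BDI2020_thm_4_2) : BDI2020_thm_4_1 := by
  intro m d f hf hd _ _ hW
  obtain ⟨c, hc⟩ := hW
  exact ⟨c, fun n => (h (m n) (d n) (f n) (hf n) (hd n)).trans (hc n)⟩

end Section4

/-! ### §6 Proposition 6.6 (arXiv Prop 12) and Question 6.9 (arXiv Question 15) -/

section Section6

open BDI2020

-- FACT (Nisan 1991 construction, symmetric version)
/-- **BDI Prop 6.6 (arXiv Prop 12), the width clause.** "If `A` is an ncABP computing a symmetric
tensor `p ∈ Sym^d V`, then there is an ncABP `B` [computing `p`, layerwise no larger than `A`, with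
symmetric tensors at its nodes, and] the `k`-th layer of `B` has precisely `dim ∂^{=k}(p)` many
vertices which is the optimal width", where (proof) `dim ∂^{=k}(p) = rank M_k(p)` for the flattening
`M_k(p)[q, q'] =` coefficient of `e_q ⊗ e_{q'}` (eq. (6.2); tree: `wordFlattening`, and
`wordTTRank Ψ = max_k rank M_k(Ψ)`). Typed consequence (clauses 1 and 4): a symmetric tensor has an
ncABP of width `≤ w` iff all its flattening ranks are `≤ w`. Clauses 2–3 (layerwise comparison,
symmetric node tensors) are not typed. Over `ℂ` as printed.
[cite: BlaserDorflerIkenmeyer2020, Prop 12 (arXiv; = CCC 2021 Prop 6.6)] locator: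
paper:arxiv-2002.11594 p0011.txt:L56-66 (statement), L67-78 (proof: `dim M_k = dim ∂^{=k}(p)`,
`M_k = L_k R_k`); CCC p.29:12 "▶ Proposition 6.6" -/
def BDI2020_prop_6_6 : Prop :=
  ∀ (m d w : ℕ) (Ψ : (Fin d → Fin m) → ℂ), IsSymmetricTensor Ψ →
    (HasNcABPWidthLE w Ψ ↔ wordTTRank Ψ ≤ w)

-- OPEN QUESTION (printed as open; neutral statement, NOT asserted, not a conjecture of the tree)
/-- **BDI Question 6.9 (arXiv Question 15), first alternative.** With `B_{k,d} := {p ∈ Sym^d V |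
ncw(p) ≤ k}` and `W_{k,d} := {p | WR(p) ≤ k}` (Cor 6.8): "Is there a polynomial `q`, such that
`B_{k,d} ⊆ W_{q(k),d} …?`" — i.e. is the Waring rank polynomially bounded in the noncommutative ABP
width, uniformly in `m` and `d`? Typed literally (`q` p-bounded, tree `IsPBounded`; `WR` = tree
`polyWaringRank`; degree `d ≥ 1`). Status in print: open (CCC 2021: "Note that the following is
still unknown"). Status in the tree (erratum 2026-08-27): this is the AS-PRINTED, `d`-UNIFORM literal
reading (`q` depends on `k` only), and it is REFUTED IN TREE by
`Literature.Computability.AlgebraicComplexity.not_BDI2020_question_6_9a` (file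
`BDI20WaringBorderWaringGap.lean`, p519059: the paper's own Cor 6.8 example `x^{d-1}y` has `ncw ≤ 2`
and `WR = d` for every `d ≥ 3`); the intended reading with `q = q(k, d)` is
`BDI2020_question_6_9a_kd` below, which stays OPEN. The statement is kept byte-identical as the
faithful transcription of the printed alternative. [cite: BlaserDorflerIkenmeyer2020, Question 15 (arXiv; = CCC 2021 Question 6.9)] locator:
paper:arxiv-2002.11594 p0012.txt:L63-66; CCC p.29:14 "▶ 6.9 Question." -/
def BDI2020_question_6_9a : Prop :=
  ∃ q : ℕ → ℕ, IsPBounded q ∧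
    ∀ (m d k : ℕ) (p : MvPolynomial (Fin m) ℂ), p.IsHomogeneous d → 0 < d →
      ncAbpWidthPoly d p ≤ k → polyWaringRank d p ≤ q k

-- OPEN QUESTION (printed as open; neutral statement, NOT asserted)
/-- **BDI Question 6.9 (arXiv Question 15), second alternative**: "… or `B_{k,d} ⊆ W̄_{q(k),d}`?"
(`W̄_{k,d} := {p | W̄R(p) ≤ k}`) — is the BORDER Waring rank polynomially bounded in the
noncommutative ABP width? (The converse direction `W̄_{k,d} ⊆ B_{k,d}` is Thm 4.2 / Cor 6.8.)
[cite: BlaserDorflerIkenmeyer2020, Question 15 (arXiv; = CCC 2021 Question 6.9)] locator: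
paper:arxiv-2002.11594 p0012.txt:L63-66; CCC p.29:14 -/
def BDI2020_question_6_9b : Prop :=
  ∃ q : ℕ → ℕ, IsPBounded q ∧
    ∀ (m d k : ℕ) (p : MvPolynomial (Fin m) ℂ), p.IsHomogeneous d → 0 < d →
      ncAbpWidthPoly d p ≤ k → borderPolyWaringRank d p ≤ q k

-- OPEN QUESTION (intended reading of Question 6.9, first alternative; neutral statement, NOT asserted,
-- not a conjecture of the tree; census-neutral). Added by seat x6 g6 per val-lit lead-np RULING (95)(c),
-- 2026-08-27, after `not_BDI2020_question_6_9a` (file `BDI20WaringBorderWaringGap.lean`) decided the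
-- LITERAL `d`-uniform reading `BDI2020_question_6_9a` in the negative with the paper's own Cor 6.8 example.
/-- **BDI Question 6.9 (arXiv Question 15), first alternative — INTENDED reading, `q = q(k, d)`.** The
printed text (paper:arxiv-2002.11594 p0012.txt:L63-66): "Note that the following is still unknown:
Question 15. Is there a polynomial `q`, such that `B_{k,d} ⊆ W_{q(k),d}` or `B_{k,d} ⊆ W̲_{q(k),d}`?"
Read LITERALLY (`q` a function of `k` alone, one bound for all degrees `d` and all `m`) the first
alternative is `BDI2020_question_6_9a`, and that reading is DECIDED IN THE NEGATIVE in the tree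
(`Literature.Computability.AlgebraicComplexity.not_BDI2020_question_6_9a`: `ncw(x^{d-1}y) ≤ 2` while
`WR(x^{d-1}y) = d`, the example printed two sentences earlier in Cor 14). The reading the authors
surely intend lets the polynomial depend on the degree as well: is there `q(k, d)`, polynomially
bounded in `k` and `d` jointly, with `WR(p) ≤ q(ncw(p), d)` for every form `p` of degree `d ≥ 1`
over `ℂ` (uniformly in the number of variables `m` — harmless, since `ncw(p) ≤ k` forces `≤ k`
essential variables)? Typed with "polynomially bounded in `(k, d)`" as `q k d ≤ (k + d)^c + c`.
STATUS: OPEN (as printed); nothing in the tree decides it. [cite: BlaserDorflerIkenmeyer2020, Question 15 (arXiv; = CCC 2021 Question 6.9), first alternative, intended `q(k,d)` reading] locator: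
paper:arxiv-2002.11594 p0012.txt:L63-66; CCC p.29:14 "▶ 6.9 Question." -/
def BDI2020_question_6_9a_kd : Prop :=
  ∃ q : ℕ → ℕ → ℕ, (∃ c : ℕ, ∀ k d, q k d ≤ (k + d) ^ c + c) ∧
    ∀ (m d k : ℕ) (p : MvPolynomial (Fin m) ℂ), p.IsHomogeneous d → 0 < d →
      ncAbpWidthPoly d p ≤ k → polyWaringRank d p ≤ q k d

-- OPEN QUESTION (intended reading of Question 6.9, second alternative; neutral statement, NOT asserted)
/-- **BDI Question 6.9 (arXiv Question 15), second alternative — INTENDED reading, `q = q(k, d)`**: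
"… or `B_{k,d} ⊆ W̲_{q(k),d}`?" with the polynomial allowed to depend on the degree: is the BORDER
Waring rank of a form of degree `d` bounded by a polynomial in `(ncw, d)`? (The literal `d`-uniform
reading is `BDI2020_question_6_9b`, which — unlike `BDI2020_question_6_9a` — is NOT decided in the
tree: for binary forms `ncw = W̲R`, and every known lower-bound method for `W̲R` is a rank method.)
STATUS: OPEN (as printed). [cite: BlaserDorflerIkenmeyer2020, Question 15 (arXiv; = CCC 2021 Question 6.9), second alternative, intended `q(k,d)` reading]
locator: paper:arxiv-2002.11594 p0012.txt:L63-66; CCC p.29:14 -/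
def BDI2020_question_6_9b_kd : Prop :=
  ∃ q : ℕ → ℕ → ℕ, (∃ c : ℕ, ∀ k d, q k d ≤ (k + d) ^ c + c) ∧
    ∀ (m d k : ℕ) (p : MvPolynomial (Fin m) ℂ), p.IsHomogeneous d → 0 < d →
      ncAbpWidthPoly d p ≤ k → borderPolyWaringRank d p ≤ q k d

-- PROVED (glue)
/-- The literal (`d`-uniform) readings imply the intended (`q(k,d)`) readings: a bound `q(k)` is in
particular a bound `q(k,d)`. [cite: BlaserDorflerIkenmeyer2020, Question 15 (arXiv; = CCC 2021 Question 6.9)] -/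
theorem BDI2020_question_6_9a_kd_of_6_9a (h : BDI2020_question_6_9a) : BDI2020_question_6_9a_kd := by
  obtain ⟨q, ⟨c, hc⟩, hq⟩ := h
  refine ⟨fun k _ => q k, ⟨c, fun k d => (hc k).trans ?_⟩, fun m d k p hp hd hk => hq m d k p hp hd hk⟩
  gcongr
  · exact Nat.le_add_right k d

/-- As above, for the second alternative. [cite: BlaserDorflerIkenmeyer2020, Question 15 (arXiv; = CCC 2021 Question 6.9)] -/
theorem BDI2020_question_6_9b_kd_of_6_9b (h : BDI2020_question_6_9b) : BDI2020_question_6_9b_kd := by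
  obtain ⟨q, ⟨c, hc⟩, hq⟩ := h
  refine ⟨fun k _ => q k, ⟨c, fun k d => (hc k).trans ?_⟩, fun m d k p hp hd hk => hq m d k p hp hd hk⟩
  gcongr
  · exact Nat.le_add_right k d

end Section6

end Literature.Computability.AlgebraicComplexity

end
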